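import Summits.BirchSwinnertonDyer.BirchSwinnertonDyer.Theorems.AlignedTransportAtTwoMainConjectureOfRankZeroBSDAtTwoHalfDescentLayerIndexCertificate
import Literature.NumberTheory.EllipticCurves.IwasawaAlgebraMuAdditiveProofs
import Literature.NumberTheory.EllipticCurves.IwasawaModuleFinitePadicIntProofs
import Literature.NumberTheory.IwasawaTheory.IwasawaModuleMuZeroOfRankJump
import HarnessLib

/-!
# Route `AlignedTransportAtTwo`, crux C2 `MainConjectureOfRankZeroBSDAtTwo` (stmt-BirchSwinnertonDyer-22298):
# THE GROWTH NUMBER WITHOUT GREENBERG 4.14, I — for EVERY finitely generated torsion `Λ`-module `X` and EVERY layer `n`, the one-step growth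
# `g_n = #(ω_n X / ω_{n+1} X)` satisfies `p^{pⁿ(p−1)·μ(X)} ∣ g_n ∣ #(X/Ψ_n X)`; hence `0 < #(X/ω_{n+1}X) < p^{pⁿ(p−1)} · #(X/ω_n X)` at ANY ONE layer ⟹ `μ(X) = 0`

HONEST FRAMING (cell `bsd-f1-sign2`, WIDTH-5 attached prover seat `bsd-line-att-p5` gen 56 on line `birth` of the lead `bsd-line-att-p2`;
`--supports` stmt-BirchSwinnertonDyer-22298, closes nothing; BSD is NOT proved by any of this; the crux C2, its verdict «blocked-on
`Rank1Residual.GreenbergMuConjectureIrreducible`» and every registered stub (P / T / Kμ / LimDoor / MuIneqʳ / PFμ⁺) are untouched). THEOREMS ONLY — pure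
commutative algebra over `Λ = ℤ_p⟦T⟧`, any prime `p`; no `def`, no instance, no named fact, no `sorry`. Sequel of gen 55's `…HalfDescentLayerIndexCertificate`
(`0 < #(X/Ψ_nX) < p^{pⁿ(p−1)} ⟹ μ(X) = 0` for EVERY f.g. torsion `X`) and gen 54's `…HalfDescentLayerIndexTower` (`#(X/ω_{n+1}X) = #(X/ω_nX)·#(X/Ψ_nX)` when `ω_n`
is `X`-regular, i.e. NO finite submodule and a rank-`0` tower).

THE POINT. `ω_n = (1+T)^{pⁿ} − 1`, `Ψ_n = Φ_{p^{n+1}}(1+T)`, `ω_{n+1} = ω_n·Ψ_n`. For ANY `Λ`-module `X` the chain `ω_{n+1}X ≤ ω_nX ≤ X` gives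
**`#(X/ω_{n+1}X) = #(X/ω_nX) · g_n`**, `g_n := #(ω_nX/Ψ_n·ω_nX)` the GROWTH NUMBER of the layer (§1, any commutative ring: `#(M/abM) = #(M/aM)·#(aM/b·aM)`), and
`x ↦ ω_n x` is a surjection `X/Ψ_nX ↠ ω_nX/ω_{n+1}X`, so **`g_n ∣ #(X/Ψ_nX)`** (the descent number of gens 54–55). The new input (§2): **`μ(ω_nX) = μ(X)`** for `X`
f.g. torsion — `μ` is additive on `0 → X[ω_n] → X → ω_nX → 0` (tree `muInvariant_add_of_shortExact_holds`) and the `ω_n`-torsion `X[ω_n]` has `μ = 0` (its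
`p`-cotorsion is a finitely generated module over the FINITE ring `Λ/(ω_n, p) = Λ/(T^{pⁿ}, p)`, tree `span_omega_sup_augIdealP_eq`, hence finite; tree
`muInvariant_eq_zero_of_finite_quotient_augIdealP`); more generally `μ(aX) = μ(X)` for every `a` with `Λ/(a, p)` finite. Then gen 55's UNCONDITIONAL divisibility
`p^{deg g·μ} ∣ #(Y/gY)`, run on the module `Y = ω_nX`, gives (§3):
* ★★★ `pow_dvd_natCard_growth`: **`p^{pⁿ(p−1)·μ(X)} ∣ g_n`** at EVERY layer `n`, for EVERY finitely generated torsion `X` (finite submodules allowed, any tower);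
* ★★★ `muInvariant_eq_zero_of_natCard_growth_pos_lt`: **`0 < g_n < p^{pⁿ(p−1)}` at ANY ONE layer ⟹ `μ(X) = 0`**, and the RATIO CERTIFICATE
  `muInvariant_eq_zero_of_natCard_quotient_omega_succ_pos_lt_mul`: **`0 < #(X/ω_{n+1}X) < p^{pⁿ(p−1)} · #(X/ω_nX)` ⟹ `μ(X) = 0`** — the WEAKEST of the lineage's
  one-layer certificates: gen 55's `0 < #(X/Ψ_nX) < p^{pⁿ(p−1)}` and `0 < #(X/ω_{n+1}X) < p^{pⁿ(p−1)}` each imply it (`g_n ≤ #(X/Ψ_nX) ≤ #(X/ω_{n+1}X)`);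
* ★★ the `μ ≥ 1` picture: `pow_mul_natCard_dvd_natCard_quotient_omega_succ` **`p^{pⁿ(p−1)μ}·#(X/ω_nX) ∣ #(X/ω_{n+1}X)`** and, up the tower,
  `pow_mul_natCard_dvd_natCard_quotient_omega` **`p^{(pⁿ−1)μ}·#(X/TX) ∣ #(X/ω_nX)`** — with `μ ≥ 1` EVERY step multiplies the index by at least `p^{pⁿ(p−1)}`.
Reading (g40's Pontryagin pair `#(X/ω_nX) = #Sel_{p^∞}(E/K_∞)^{Γ_n}`, sequel `…GrowthSelmer`): `μ(X(E/K_∞)) = 0` as soon as ONE step of the tower has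
`#Sel_∞^{Γ_{n+1}} < p^{pⁿ(p−1)}·#Sel_∞^{Γ_n}`. What is NOT claimed: no such number is computed here for any curve; nothing about any curve is asserted.
Memo `Cruxes/MainConjectureOfRankZeroBSDAtTwo/LAYER-GROWTH-att-p5-g56.md`.

References: K. Iwasawa, Bull. AMS 65 (1959) §§4–5; L. Washington, GTM 83, §13.2 (Nakayama, `μ = 0 ⟺` f.g. over `ℤ_p`) and §13.3 (Lemma 13.18, Thm. 13.13)
[Washington1997]; J. Neukirch, A. Schmidt, K. Wingberg, *Cohomology of Number Fields*, (5.3.10)–(5.3.17) [NeukirchSchmidtWingberg2008]; R. Greenberg, LNM 1716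
(1999), §1 pp. 60–65, Conj. 1.11, Prop. 4.14–4.15 [GreenbergLNM1716]; S. Lang, *Cyclotomic Fields I–II*, Ch. 5 §1 [Lang1990].
-/

set_option linter.dupNamespace false
set_option autoImplicit false

noncomputable section

open scoped Classical Polynomial

namespace Summit.BirchSwinnertonDyer.BirchSwinnertonDyer.Theorems.AlignedTransportAtTwoHalfDescentLayerIndexGrowth

open Literature.NumberTheory.EllipticCurves Literature.NumberTheory.EllipticCurves.IwasawaAlgebra
  Literature.NumberTheory.EllipticCurves.IwasawaModuleFinitePadicInt
  Literature.NumberTheory.IwasawaTheory.IwasawaModuleRankJump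
  Summit.BirchSwinnertonDyer.Rank1Residual.X1.MuLambda
  Summit.BirchSwinnertonDyer.Rank1Residual.X1.GeneratorBoundMu
  Summit.BirchSwinnertonDyer.Rank1Residual.Iwasawa
  Summit.BirchSwinnertonDyer.BirchSwinnertonDyer.Theorems.DefectPrime
  Summit.BirchSwinnertonDyer.BirchSwinnertonDyer.Theorems.AlignedTransportAtTwoCyclotomicLayerPrime
  Summit.BirchSwinnertonDyer.BirchSwinnertonDyer.Theorems.AlignedTransportAtTwoHalfDescentLayerRing
  Summit.BirchSwinnertonDyer.BirchSwinnertonDyer.Theorems.AlignedTransportAtTwoHalfDescentLayerIndex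
  Summit.BirchSwinnertonDyer.BirchSwinnertonDyer.Theorems.AlignedTransportAtTwoHalfDescentLayerIndexModule
  Summit.BirchSwinnertonDyer.BirchSwinnertonDyer.Theorems.AlignedTransportAtTwoHalfDescentLayerIndexTower
  Summit.BirchSwinnertonDyer.BirchSwinnertonDyer.Theorems.AlignedTransportAtTwoHalfDescentLayerIndexFinite
  Summit.BirchSwinnertonDyer.BirchSwinnertonDyer.Theorems.AlignedTransportAtTwoHalfDescentLayerIndexCertificate

universe u

/-! ## §1 `#(M/abM) = #(M/aM) · #(aM/b·aM)` and `#(aM/b·aM) ∣ #(M/bM)` (any commutative ring) -/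

section Ring

variable {R : Type*} [CommRing R] {M : Type*} [AddCommGroup M] [Module R M]

/-- Inside `M`, the submodule `b·(aM)` of `aM` is `abM`. [folklore] -/
theorem map_subtype_smul_top_smul_top (a b : R) :
    ((Ideal.span {b} • ⊤ : Submodule R ↥(Ideal.span {a} • ⊤ : Submodule R M))).map (Ideal.span {a} • ⊤ : Submodule R M).subtype =
      (Ideal.span {a * b} • ⊤ : Submodule R M) := by
  rw [Submodule.map_smul'', Submodule.map_subtype_top, ← Submodule.mul_smul, Ideal.span_singleton_mul_span_singleton, mul_comm b a]

/-- `abM ≤ aM`. [folklore] -/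
theorem smul_top_mul_le (a b : R) : (Ideal.span {a * b} • ⊤ : Submodule R M) ≤ (Ideal.span {a} • ⊤ : Submodule R M) := by
  rw [← map_subtype_smul_top_smul_top a b]
  exact Submodule.map_subtype_le _ _

/-- **`#(M/abM) = #(M/aM) · #(aM/b·aM)`** for every commutative ring `R`, `R`-module `M` and `a, b ∈ R` (the chain `abM ≤ aM ≤ M`; `Nat.card`, so the identity
holds verbatim when some quotient is infinite). [cite: Washington1997, §13.3 (Lemma 13.18)] -/
theorem natCard_quotient_mul_smul_top_eq (a b : R) :
    Nat.card (M ⧸ (Ideal.span {a * b} • ⊤ : Submodule R M)) =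
      Nat.card (M ⧸ (Ideal.span {a} • ⊤ : Submodule R M)) *
        Nat.card (↥(Ideal.span {a} • ⊤ : Submodule R M) ⧸ (Ideal.span {b} • ⊤ : Submodule R ↥(Ideal.span {a} • ⊤ : Submodule R M))) := by
  set A : Submodule R M := Ideal.span {a} • ⊤ with hA
  set C : Submodule R M := Ideal.span {a * b} • ⊤ with hC
  set B : Submodule R A := Ideal.span {b} • ⊤ with hB
  have hBC : B.map A.subtype = C := map_subtype_smul_top_smul_top a b
  have hCA : C ≤ A := smul_top_mul_le a b
  set ι : A →ₗ[R] M ⧸ C := C.mkQ.comp A.subtype with hι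
  have hι_range : LinearMap.range ι = A.map C.mkQ := by rw [hι, LinearMap.range_comp, Submodule.range_subtype]
  have hι_ker : LinearMap.ker ι = B := by
    rw [hι, LinearMap.ker_comp, Submodule.ker_mkQ, ← hBC, Submodule.comap_map_eq_of_injective (Submodule.injective_subtype A)]
  have hcardA : Nat.card ↥(A.map C.mkQ) = Nat.card (A ⧸ B) := by
    rw [← hι_range, ← Nat.card_congr ι.quotKerEquivRange.toEquiv, Nat.card_congr (Submodule.quotEquivOfEq _ _ hι_ker).toEquiv]
  rw [Submodule.card_eq_card_quotient_mul_card (A.map C.mkQ), hcardA, Nat.card_congr (Submodule.quotientQuotientEquivQuotient C A hCA).toEquiv,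
    mul_comm]

/-- **`#(aM/b·aM) ∣ #(M/bM)`**: `x ↦ a·x` induces a surjection `M/bM ↠ aM/abM`. [cite: Washington1997, §13.3] -/
theorem natCard_smul_top_quotient_dvd (a b : R) :
    Nat.card (↥(Ideal.span {a} • ⊤ : Submodule R M) ⧸ (Ideal.span {b} • ⊤ : Submodule R ↥(Ideal.span {a} • ⊤ : Submodule R M))) ∣
      Nat.card (M ⧸ (Ideal.span {b} • ⊤ : Submodule R M)) := by
  set A : Submodule R M := Ideal.span {a} • ⊤ with hA
  set B : Submodule R A := Ideal.span {b} • ⊤ with hB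
  have hmem : ∀ x : M, (LinearMap.lsmul R M a) x ∈ A := fun x ↦ by
    rw [LinearMap.lsmul_apply]
    exact Submodule.smul_mem_smul (Ideal.mem_span_singleton_self a) Submodule.mem_top
  set φ : M →ₗ[R] A := LinearMap.codRestrict A (LinearMap.lsmul R M a) hmem with hφ
  have hφ_apply : ∀ x : M, (φ x : M) = a • x := fun x ↦ rfl
  have hφsurj : Function.Surjective φ := by
    rintro ⟨y, hy⟩
    have hy' := hy
    rw [hA, Submodule.ideal_span_singleton_smul, Submodule.mem_smul_pointwise_iff_exists] at hy'
    obtain ⟨x, -, hx⟩ := hy'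
    exact ⟨x, Subtype.ext (by rw [hφ_apply, hx])⟩
  have hle : (Ideal.span {b} • ⊤ : Submodule R M) ≤ B.comap φ := by
    refine Submodule.smul_le.mpr fun r hr x _ ↦ ?_
    rw [Submodule.mem_comap, map_smul]
    exact Submodule.smul_mem_smul hr Submodule.mem_top
  set ψ := (Ideal.span {b} • ⊤ : Submodule R M).mapQ B φ hle with hψ
  have hψsurj : Function.Surjective ψ := by
    rw [← LinearMap.range_eq_top, hψ, Submodule.range_mapQ, LinearMap.range_eq_top.mpr hφsurj, Submodule.map_top, Submodule.range_mkQ]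
  rw [Submodule.card_eq_card_quotient_mul_card (LinearMap.ker ψ), Nat.card_congr (ψ.quotKerEquivOfSurjective hψsurj).toEquiv]
  exact Dvd.intro_left _ rfl

/-- `#M = #(aM) · #(M/aM)`. [folklore] -/
theorem natCard_eq_natCard_smul_top_mul_natCard_quotient (a : R) :
    Nat.card M = Nat.card ↥(Ideal.span {a} • ⊤ : Submodule R M) * Nat.card (M ⧸ (Ideal.span {a} • ⊤ : Submodule R M)) :=
  Submodule.card_eq_card_quotient_mul_card _

end Ring

/-! ## §2 `μ(aX) = μ(X)` whenever `Λ/(a, p)` is finite; in particular `μ(ω_n X) = μ(X)` -/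

section Mu

variable {p : ℕ} [hp : Fact p.Prime] {M : Type u} [AddCommGroup M] [Module (IwasawaAlgebra p) M]

/-- **A finitely generated torsion `Λ`-module killed by `a` with `Λ/(a, p)` finite has `μ = 0`**: its `p`-cotorsion `N/pN` is a finitely generated module over the
finite ring `Λ/(a, p)`, hence finite (tree `muInvariant_eq_zero_of_finite_quotient_augIdealP`). [cite: Washington1997, §13.2] [cite: GreenbergVatsal2000, §2 Prop. (2.8)] -/
theorem muInvariant_eq_zero_of_smul_eq_zero {N : Type u} [AddCommGroup N] [Module (IwasawaAlgebra p) N] [Module.Finite (IwasawaAlgebra p) N]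
    (hN : Module.IsTorsion (IwasawaAlgebra p) N) {a : IwasawaAlgebra p} (hfin : Finite (IwasawaAlgebra p ⧸ (Ideal.span {a} ⊔ augIdealP p)))
    (ha : ∀ x : N, a • x = 0) : muInvariant p N = 0 := by
  haveI := hfin
  have hJ : ∀ r ∈ Ideal.span {a} ⊔ augIdealP p, ∀ x : N ⧸ (augIdealP p • (⊤ : Submodule (IwasawaAlgebra p) N)), r • x = 0 := by
    intro r hr x
    obtain ⟨s, hs, t, ht, rfl⟩ := Submodule.mem_sup.mp hr
    obtain ⟨c, rfl⟩ := Ideal.mem_span_singleton'.mp hs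
    induction x using Submodule.Quotient.induction_on with
    | H x =>
      rw [add_smul, ← Submodule.Quotient.mk_smul, ← Submodule.Quotient.mk_smul, mul_smul, ha, smul_zero, Submodule.Quotient.mk_zero, zero_add,
        Submodule.Quotient.mk_eq_zero]
      exact Submodule.smul_mem_smul ht Submodule.mem_top
  have hfinQ : Finite (N ⧸ (augIdealP p • (⊤ : Submodule (IwasawaAlgebra p) N))) :=
    finite_of_smul_eq_zero_of_finite_quotient (Ideal.span {a} ⊔ augIdealP p) hJ
  exact muInvariant_eq_zero_of_finite_quotient_augIdealP p N hN hfinQ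

/-- ★★ **`μ(aX) = μ(X)`** for `X` finitely generated torsion and ANY `a ∈ Λ` with `Λ/(a, p)` finite: `μ` is additive on `0 → X[a] → X —a→ aX → 0` and `μ(X[a]) = 0`.
[cite: Washington1997, §13.2] [cite: GreenbergLNM1716, §5 (Remark after Cor. 5.5)] -/
theorem muInvariant_smul_top_eq [Module.Finite (IwasawaAlgebra p) M] (hM : Module.IsTorsion (IwasawaAlgebra p) M) {a : IwasawaAlgebra p}
    (hfin : Finite (IwasawaAlgebra p ⧸ (Ideal.span {a} ⊔ augIdealP p))) :
    muInvariant p ↥(Ideal.span {a} • ⊤ : Submodule (IwasawaAlgebra p) M) = muInvariant p M := by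
  haveI : IsNoetherian (IwasawaAlgebra p) M := inferInstance
  set A : Submodule (IwasawaAlgebra p) M := Ideal.span {a} • ⊤ with hA
  have hmem : ∀ x : M, (LinearMap.lsmul (IwasawaAlgebra p) M a) x ∈ A := fun x ↦ by
    rw [LinearMap.lsmul_apply]
    exact Submodule.smul_mem_smul (Ideal.mem_span_singleton_self a) Submodule.mem_top
  set φ : M →ₗ[IwasawaAlgebra p] A := LinearMap.codRestrict A (LinearMap.lsmul (IwasawaAlgebra p) M a) hmem with hφ
  have hφ_apply : ∀ x : M, (φ x : M) = a • x := fun x ↦ rfl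
  have hφsurj : Function.Surjective φ := by
    rintro ⟨y, hy⟩
    have hy' := hy
    rw [hA, Submodule.ideal_span_singleton_smul, Submodule.mem_smul_pointwise_iff_exists] at hy'
    obtain ⟨x, -, hx⟩ := hy'
    exact ⟨x, Subtype.ext (by rw [hφ_apply, hx])⟩
  set K : Submodule (IwasawaAlgebra p) M := LinearMap.ker φ with hK
  have hadd := muInvariant_add_of_shortExact_holds p M hM K.subtype φ (Submodule.injective_subtype K) hφsurj (LinearMap.exact_subtype_ker_map φ)
  haveI : Module.Finite (IwasawaAlgebra p) K := Module.Finite.of_injective K.subtype (Submodule.injective_subtype K)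
  have hKtors : Module.IsTorsion (IwasawaAlgebra p) K := Literature.NumberTheory.EllipticCurves.isTorsion_of_injective K.subtype (Submodule.injective_subtype K) hM
  have hKa : ∀ x : K, a • x = 0 := by
    rintro ⟨x, hx⟩
    apply Subtype.ext
    have hx' : (φ x : M) = 0 := by rw [LinearMap.mem_ker.mp hx]; rfl
    rw [hφ_apply] at hx'
    exact hx'
  rw [muInvariant_eq_zero_of_smul_eq_zero hKtors hfin hKa, zero_add] at hadd
  exact hadd.symm

variable (p) in
/-- `Λ/(ω_n, p)` is finite (`(ω_n, p) = (T^{pⁿ}, p)`, tree). [cite: Washington1997, §13.2 and §13.3 (proof of Lemma 13.18)] -/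
theorem finite_quotient_span_omega_sup_augIdealP (n : ℕ) :
    Finite (IwasawaAlgebra p ⧸ (Ideal.span {((1 + PowerSeries.X : PowerSeries ℤ_[p]) ^ (p ^ n) - 1 : IwasawaAlgebra p)} ⊔ augIdealP p)) := by
  rw [span_omega_sup_augIdealP_eq p n]
  exact finite_quotient_span_X_pow_sup_augIdealP p (Nat.one_le_pow n p hp.out.pos)

/-- ★★ **`μ(ω_n X) = μ(X)`** for every finitely generated torsion `Λ`-module `X` and every `n` (`ω_n = (1+T)^{pⁿ} − 1`): the `ω_n`-torsion `X[ω_n]` — a module over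
`Λ/ω_n ≅ ℤ_p[C_{pⁿ}]`, finitely generated over `ℤ_p` — carries no `μ`. [cite: Washington1997, §13.2–13.3] [cite: GreenbergLNM1716, §5] -/
theorem muInvariant_smul_top_omega_eq [Module.Finite (IwasawaAlgebra p) M] (hM : Module.IsTorsion (IwasawaAlgebra p) M) (n : ℕ) :
    muInvariant p ↥(Ideal.span {((1 + PowerSeries.X : PowerSeries ℤ_[p]) ^ (p ^ n) - 1 : IwasawaAlgebra p)} • ⊤ : Submodule (IwasawaAlgebra p) M) =
      muInvariant p M :=
  muInvariant_smul_top_eq hM (finite_quotient_span_omega_sup_augIdealP p n)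

end Mu

/-! ## §3 The growth number `g_n = #(ω_nX/ω_{n+1}X)`: `p^{pⁿ(p−1)μ(X)} ∣ g_n ∣ #(X/Ψ_nX)`, and the ratio certificate -/

section Growth

variable {p : ℕ} [hp : Fact p.Prime] {M : Type u} [AddCommGroup M] [Module (IwasawaAlgebra p) M]

variable (p) in
/-- `ω_n · Ψ_n = ω_{n+1}`. [cite: Washington1997, §13.2] -/
theorem omega_mul_cyclotomicLayer (n : ℕ) :
    (((1 + PowerSeries.X : PowerSeries ℤ_[p]) ^ (p ^ n) - 1 : IwasawaAlgebra p)) *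
        ((((Polynomial.cyclotomic (p ^ (n + 1)) ℤ_[p]).comp (Polynomial.X + 1) : ℤ_[p][X]) : IwasawaAlgebra p)) =
      (((1 + PowerSeries.X : PowerSeries ℤ_[p]) ^ (p ^ (n + 1)) - 1 : IwasawaAlgebra p)) := by
  rw [mul_comm]; exact coe_cyclotomicLayer_mul_omega p n

/-- ★ **`#(X/ω_{n+1}X) = #(X/ω_nX) · g_n`**, `g_n = #(ω_nX/Ψ_n·ω_nX) = #(ω_nX/ω_{n+1}X)` the GROWTH NUMBER of the layer — for EVERY `Λ`-module `X` and every `n`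
(`Nat.card`). [cite: Washington1997, §13.3 (Lemma 13.18, Thm. 13.13)] -/
theorem natCard_quotient_omega_succ_eq_mul_growth (n : ℕ) :
    Nat.card (M ⧸ (Ideal.span {((1 + PowerSeries.X : PowerSeries ℤ_[p]) ^ (p ^ (n + 1)) - 1 : IwasawaAlgebra p)} • ⊤ : Submodule (IwasawaAlgebra p) M)) =
      Nat.card (M ⧸ (Ideal.span {((1 + PowerSeries.X : PowerSeries ℤ_[p]) ^ (p ^ n) - 1 : IwasawaAlgebra p)} • ⊤ : Submodule (IwasawaAlgebra p) M)) *
        Nat.card (↥(Ideal.span {((1 + PowerSeries.X : PowerSeries ℤ_[p]) ^ (p ^ n) - 1 : IwasawaAlgebra p)} • ⊤ : Submodule (IwasawaAlgebra p) M) ⧸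
          (Ideal.span {(((Polynomial.cyclotomic (p ^ (n + 1)) ℤ_[p]).comp (Polynomial.X + 1) : ℤ_[p][X]) : IwasawaAlgebra p)} • ⊤ :
            Submodule (IwasawaAlgebra p) ↥(Ideal.span {((1 + PowerSeries.X : PowerSeries ℤ_[p]) ^ (p ^ n) - 1 : IwasawaAlgebra p)} • ⊤ :
              Submodule (IwasawaAlgebra p) M))) := by
  rw [← omega_mul_cyclotomicLayer p n]
  exact natCard_quotient_mul_smul_top_eq _ _

/-- ★ **`g_n ∣ #(X/Ψ_nX)`**: the growth number divides the descent number (`x ↦ ω_n x` is a surjection `X/Ψ_nX ↠ ω_nX/ω_{n+1}X`), for EVERY `Λ`-module `X`.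
[cite: Washington1997, §13.3] -/
theorem natCard_growth_dvd_natCard_layerQuotient (n : ℕ) :
    Nat.card (↥(Ideal.span {((1 + PowerSeries.X : PowerSeries ℤ_[p]) ^ (p ^ n) - 1 : IwasawaAlgebra p)} • ⊤ : Submodule (IwasawaAlgebra p) M) ⧸
        (Ideal.span {(((Polynomial.cyclotomic (p ^ (n + 1)) ℤ_[p]).comp (Polynomial.X + 1) : ℤ_[p][X]) : IwasawaAlgebra p)} • ⊤ :
          Submodule (IwasawaAlgebra p) ↥(Ideal.span {((1 + PowerSeries.X : PowerSeries ℤ_[p]) ^ (p ^ n) - 1 : IwasawaAlgebra p)} • ⊤ :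
            Submodule (IwasawaAlgebra p) M))) ∣
      Nat.card (M ⧸ (Ideal.span {(((Polynomial.cyclotomic (p ^ (n + 1)) ℤ_[p]).comp (Polynomial.X + 1) : ℤ_[p][X]) : IwasawaAlgebra p)} • ⊤ :
        Submodule (IwasawaAlgebra p) M)) :=
  natCard_smul_top_quotient_dvd _ _

/-- **`#(X/ω_{n+1}X) ∣ #(X/ω_nX) · #(X/Ψ_nX)`** for EVERY `Λ`-module `X` (equality is gen 54's tower product when `ω_n` is `X`-regular). [cite: Washington1997, §13.3 (Lemma 13.18)] -/
theorem natCard_quotient_omega_succ_dvd_mul (n : ℕ) :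
    Nat.card (M ⧸ (Ideal.span {((1 + PowerSeries.X : PowerSeries ℤ_[p]) ^ (p ^ (n + 1)) - 1 : IwasawaAlgebra p)} • ⊤ : Submodule (IwasawaAlgebra p) M)) ∣
      Nat.card (M ⧸ (Ideal.span {((1 + PowerSeries.X : PowerSeries ℤ_[p]) ^ (p ^ n) - 1 : IwasawaAlgebra p)} • ⊤ : Submodule (IwasawaAlgebra p) M)) *
        Nat.card (M ⧸ (Ideal.span {(((Polynomial.cyclotomic (p ^ (n + 1)) ℤ_[p]).comp (Polynomial.X + 1) : ℤ_[p][X]) : IwasawaAlgebra p)} • ⊤ :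
          Submodule (IwasawaAlgebra p) M)) := by
  rw [natCard_quotient_omega_succ_eq_mul_growth n]
  exact mul_dvd_mul_left _ (natCard_growth_dvd_natCard_layerQuotient n)

/-- ★★★ **`p^{pⁿ(p−1)·μ(X)} ∣ g_n` UNCONDITIONALLY**: for EVERY finitely generated torsion `Λ`-module `X` (finite submodules allowed, any tower) and EVERY `n`, the growth
number `g_n = #(ω_nX/ω_{n+1}X)` is divisible by `p^{pⁿ(p−1)·μ(X)}` (`Nat.card`; reads `∣ 0` when the step is infinite): gen 55's unconditional divisibility for the
module `ω_nX`, whose `μ` is `μ(X)` (§2). [cite: Washington1997, §13.3 (Thm. 13.13)] [cite: NeukirchSchmidtWingberg2008, (5.3.17)] -/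
theorem pow_dvd_natCard_growth [Module.Finite (IwasawaAlgebra p) M] (hM : Module.IsTorsion (IwasawaAlgebra p) M) (n : ℕ) :
    p ^ (p ^ n * (p - 1) * muInvariant p M) ∣
      Nat.card (↥(Ideal.span {((1 + PowerSeries.X : PowerSeries ℤ_[p]) ^ (p ^ n) - 1 : IwasawaAlgebra p)} • ⊤ : Submodule (IwasawaAlgebra p) M) ⧸
        (Ideal.span {(((Polynomial.cyclotomic (p ^ (n + 1)) ℤ_[p]).comp (Polynomial.X + 1) : ℤ_[p][X]) : IwasawaAlgebra p)} • ⊤ :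
          Submodule (IwasawaAlgebra p) ↥(Ideal.span {((1 + PowerSeries.X : PowerSeries ℤ_[p]) ^ (p ^ n) - 1 : IwasawaAlgebra p)} • ⊤ :
            Submodule (IwasawaAlgebra p) M))) := by
  haveI : IsNoetherian (IwasawaAlgebra p) M := inferInstance
  set A : Submodule (IwasawaAlgebra p) M := Ideal.span {((1 + PowerSeries.X : PowerSeries ℤ_[p]) ^ (p ^ n) - 1 : IwasawaAlgebra p)} • ⊤ with hA
  haveI : Module.Finite (IwasawaAlgebra p) A := Module.Finite.of_injective A.subtype (Submodule.injective_subtype A)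
  have hAtors : Module.IsTorsion (IwasawaAlgebra p) A := Literature.NumberTheory.EllipticCurves.isTorsion_of_injective A.subtype (Submodule.injective_subtype A) hM
  obtain ⟨f, hf0, hchar⟩ := exists_charGenerator_ne_zero (↥A) hAtors
  have hμ : mu f = muInvariant p M := by
    rw [Summit.BirchSwinnertonDyer.Rank1Residual.X1.MuPart.mu_generator_eq_muInvariant (↥A) hAtors hf0 hchar, hA, muInvariant_smul_top_omega_eq hM n]
  rw [← hμ, ← natDegree_cyclotomicLayer p n]
  exact pow_dvd_natCard_quotient_smul_top' (cyclotomic_comp_isDistinguishedAt_maximalIdeal p n) (constantCoeff_cyclotomicLayer p n)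
    (prime_coe_cyclotomic_comp p n) hAtors hchar

/-- ★★★ **`0 < g_n < p^{pⁿ(p−1)}` at ANY ONE layer ⟹ `μ(X) = 0`** (`X` ANY finitely generated torsion `Λ`-module, `g_n = #(ω_nX/ω_{n+1}X)`): the weakest one-layer
`μ = 0` certificate of the lineage — a growth number divides the descent number `#(X/Ψ_nX)`, so gen 55's certificate implies this one. [cite: Washington1997, §13.3 (Thm. 13.13)]
[cite: GreenbergLNM1716, Conj. 1.11] -/
theorem muInvariant_eq_zero_of_natCard_growth_pos_lt [Module.Finite (IwasawaAlgebra p) M] (hM : Module.IsTorsion (IwasawaAlgebra p) M) {n : ℕ}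
    (hpos : 0 < Nat.card (↥(Ideal.span {((1 + PowerSeries.X : PowerSeries ℤ_[p]) ^ (p ^ n) - 1 : IwasawaAlgebra p)} • ⊤ : Submodule (IwasawaAlgebra p) M) ⧸
        (Ideal.span {(((Polynomial.cyclotomic (p ^ (n + 1)) ℤ_[p]).comp (Polynomial.X + 1) : ℤ_[p][X]) : IwasawaAlgebra p)} • ⊤ :
          Submodule (IwasawaAlgebra p) ↥(Ideal.span {((1 + PowerSeries.X : PowerSeries ℤ_[p]) ^ (p ^ n) - 1 : IwasawaAlgebra p)} • ⊤ :
            Submodule (IwasawaAlgebra p) M))))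
    (hlt : Nat.card (↥(Ideal.span {((1 + PowerSeries.X : PowerSeries ℤ_[p]) ^ (p ^ n) - 1 : IwasawaAlgebra p)} • ⊤ : Submodule (IwasawaAlgebra p) M) ⧸
        (Ideal.span {(((Polynomial.cyclotomic (p ^ (n + 1)) ℤ_[p]).comp (Polynomial.X + 1) : ℤ_[p][X]) : IwasawaAlgebra p)} • ⊤ :
          Submodule (IwasawaAlgebra p) ↥(Ideal.span {((1 + PowerSeries.X : PowerSeries ℤ_[p]) ^ (p ^ n) - 1 : IwasawaAlgebra p)} • ⊤ :
            Submodule (IwasawaAlgebra p) M))) < p ^ (p ^ n * (p - 1))) : muInvariant p M = 0 := by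
  have hle := (Nat.le_of_dvd hpos (pow_dvd_natCard_growth hM n)).trans_lt hlt
  have hexp := (Nat.pow_lt_pow_iff_right hp.out.one_lt).mp hle
  by_contra hμ
  have h1 : 1 ≤ muInvariant p M := Nat.one_le_iff_ne_zero.mpr hμ
  have : p ^ n * (p - 1) ≤ p ^ n * (p - 1) * muInvariant p M := Nat.le_mul_of_pos_right _ h1
  omega

/-- ★★★ **THE RATIO CERTIFICATE: `0 < #(X/ω_{n+1}X) < p^{pⁿ(p−1)} · #(X/ω_nX)` at ANY ONE layer ⟹ `μ(X) = 0`** — for EVERY finitely generated torsion `Λ`-module `X`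
(finite submodules allowed), with no structure theorem at the layer, no `λ`, no exact count: ONE STEP OF SUB-MAXIMAL GROWTH of the `ω_n`-coinvariant indices kills `μ`.
Gen 55's invariants certificate `0 < #(X/ω_{n+1}X) < p^{pⁿ(p−1)}` is the special case `#(X/ω_nX) ≥ 1` dropped. [cite: Washington1997, §13.3 (Thm. 13.13)]
[cite: GreenbergLNM1716, Conj. 1.11 and §1 pp. 60–65] -/
theorem muInvariant_eq_zero_of_natCard_quotient_omega_succ_pos_lt_mul [Module.Finite (IwasawaAlgebra p) M] (hM : Module.IsTorsion (IwasawaAlgebra p) M)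
    {n : ℕ} (hpos : 0 < Nat.card (M ⧸ (Ideal.span {((1 + PowerSeries.X : PowerSeries ℤ_[p]) ^ (p ^ (n + 1)) - 1 : IwasawaAlgebra p)} • ⊤ :
      Submodule (IwasawaAlgebra p) M)))
    (hlt : Nat.card (M ⧸ (Ideal.span {((1 + PowerSeries.X : PowerSeries ℤ_[p]) ^ (p ^ (n + 1)) - 1 : IwasawaAlgebra p)} • ⊤ : Submodule (IwasawaAlgebra p) M)) <
      p ^ (p ^ n * (p - 1)) *
        Nat.card (M ⧸ (Ideal.span {((1 + PowerSeries.X : PowerSeries ℤ_[p]) ^ (p ^ n) - 1 : IwasawaAlgebra p)} • ⊤ : Submodule (IwasawaAlgebra p) M))) :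
    muInvariant p M = 0 := by
  rw [natCard_quotient_omega_succ_eq_mul_growth n] at hpos hlt
  obtain ⟨-, hg⟩ := CanonicallyOrderedAdd.mul_pos.mp hpos
  rw [mul_comm (p ^ (p ^ n * (p - 1)))] at hlt
  exact muInvariant_eq_zero_of_natCard_growth_pos_lt hM hg (Nat.lt_of_mul_lt_mul_left hlt)

/-- ★★ **`p^{pⁿ(p−1)·μ(X)} · #(X/ω_nX) ∣ #(X/ω_{n+1}X)`** for EVERY finitely generated torsion `X` and every `n`: with `μ ≥ 1` every step of the tower multiplies the index
of the `ω`-coinvariants by at least `p^{pⁿ(p−1)}` (when finite). [cite: Washington1997, §13.3 (Thm. 13.13)] [cite: NeukirchSchmidtWingberg2008, (5.3.17)] -/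
theorem pow_mul_natCard_dvd_natCard_quotient_omega_succ [Module.Finite (IwasawaAlgebra p) M] (hM : Module.IsTorsion (IwasawaAlgebra p) M) (n : ℕ) :
    p ^ (p ^ n * (p - 1) * muInvariant p M) *
        Nat.card (M ⧸ (Ideal.span {((1 + PowerSeries.X : PowerSeries ℤ_[p]) ^ (p ^ n) - 1 : IwasawaAlgebra p)} • ⊤ : Submodule (IwasawaAlgebra p) M)) ∣
      Nat.card (M ⧸ (Ideal.span {((1 + PowerSeries.X : PowerSeries ℤ_[p]) ^ (p ^ (n + 1)) - 1 : IwasawaAlgebra p)} • ⊤ : Submodule (IwasawaAlgebra p) M)) := by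
  rw [natCard_quotient_omega_succ_eq_mul_growth n, mul_comm]
  exact mul_dvd_mul_left _ (pow_dvd_natCard_growth hM n)

/-- ★★ **Up the tower: `p^{(pⁿ−1)·μ(X)} · #(X/TX) ∣ #(X/ω_nX)`** (`ω_0 = T`, `∑_{m<n} p^m(p−1) = pⁿ − 1`) for EVERY finitely generated torsion `X`.
[cite: Washington1997, §13.3 (Thm. 13.13)] -/
theorem pow_mul_natCard_dvd_natCard_quotient_omega [Module.Finite (IwasawaAlgebra p) M] (hM : Module.IsTorsion (IwasawaAlgebra p) M) (n : ℕ) :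
    p ^ ((p ^ n - 1) * muInvariant p M) * Nat.card (M ⧸ (Ideal.span {(PowerSeries.X : IwasawaAlgebra p)} • ⊤ : Submodule (IwasawaAlgebra p) M)) ∣
      Nat.card (M ⧸ (Ideal.span {((1 + PowerSeries.X : PowerSeries ℤ_[p]) ^ (p ^ n) - 1 : IwasawaAlgebra p)} • ⊤ : Submodule (IwasawaAlgebra p) M)) := by
  induction n with
  | zero => rw [pow_zero, Nat.sub_self, zero_mul, pow_zero, one_mul, pow_one, add_sub_cancel_left]
  | succ n ih =>
    have hstep := pow_mul_natCard_dvd_natCard_quotient_omega_succ hM n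
    have h2 := (mul_dvd_mul_left (p ^ (p ^ n * (p - 1) * muInvariant p M)) ih).trans hstep
    have hp1 : 1 ≤ p := hp.out.one_lt.le
    have hpn : 1 ≤ p ^ n := Nat.one_le_pow n p hp.out.pos
    have e : p ^ n * (p - 1) * muInvariant p M + (p ^ n - 1) * muInvariant p M = (p ^ (n + 1) - 1) * muInvariant p M := by
      have e1 : p ^ n * (p - 1) + (p ^ n - 1) = p ^ (n + 1) - 1 := by
        zify [hp1, hpn, Nat.one_le_pow (n + 1) p hp.out.pos]
        ring
      rw [← e1]; ring
    rwa [← mul_assoc, ← pow_add, e] at h2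

/-- **Comparison with the descent-number certificate**: when the descent number `#(X/Ψ_nX)` is positive (finite layer quotient) the growth number is positive and at most
it, so gen 55's hypothesis `0 < #(X/Ψ_nX) < p^{pⁿ(p−1)}` implies this file's `0 < g_n < p^{pⁿ(p−1)}`. [cite: Washington1997, §13.3] -/
theorem natCard_growth_pos_and_le_of_natCard_layerQuotient_pos {n : ℕ}
    (hpos : 0 < Nat.card (M ⧸ (Ideal.span {(((Polynomial.cyclotomic (p ^ (n + 1)) ℤ_[p]).comp (Polynomial.X + 1) : ℤ_[p][X]) : IwasawaAlgebra p)} • ⊤ :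
      Submodule (IwasawaAlgebra p) M))) :
    0 < Nat.card (↥(Ideal.span {((1 + PowerSeries.X : PowerSeries ℤ_[p]) ^ (p ^ n) - 1 : IwasawaAlgebra p)} • ⊤ : Submodule (IwasawaAlgebra p) M) ⧸
        (Ideal.span {(((Polynomial.cyclotomic (p ^ (n + 1)) ℤ_[p]).comp (Polynomial.X + 1) : ℤ_[p][X]) : IwasawaAlgebra p)} • ⊤ :
          Submodule (IwasawaAlgebra p) ↥(Ideal.span {((1 + PowerSeries.X : PowerSeries ℤ_[p]) ^ (p ^ n) - 1 : IwasawaAlgebra p)} • ⊤ :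
            Submodule (IwasawaAlgebra p) M))) ∧
      Nat.card (↥(Ideal.span {((1 + PowerSeries.X : PowerSeries ℤ_[p]) ^ (p ^ n) - 1 : IwasawaAlgebra p)} • ⊤ : Submodule (IwasawaAlgebra p) M) ⧸
        (Ideal.span {(((Polynomial.cyclotomic (p ^ (n + 1)) ℤ_[p]).comp (Polynomial.X + 1) : ℤ_[p][X]) : IwasawaAlgebra p)} • ⊤ :
          Submodule (IwasawaAlgebra p) ↥(Ideal.span {((1 + PowerSeries.X : PowerSeries ℤ_[p]) ^ (p ^ n) - 1 : IwasawaAlgebra p)} • ⊤ :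
            Submodule (IwasawaAlgebra p) M))) ≤
        Nat.card (M ⧸ (Ideal.span {(((Polynomial.cyclotomic (p ^ (n + 1)) ℤ_[p]).comp (Polynomial.X + 1) : ℤ_[p][X]) : IwasawaAlgebra p)} • ⊤ :
          Submodule (IwasawaAlgebra p) M)) := by
  have hdvd := natCard_growth_dvd_natCard_layerQuotient (p := p) (M := M) n
  refine ⟨Nat.pos_of_ne_zero fun h0 ↦ ?_, Nat.le_of_dvd hpos hdvd⟩
  rw [h0, zero_dvd_iff] at hdvd
  omega

end Growth

end Summit.BirchSwinnertonDyer.BirchSwinnertonDyer.Theorems.AlignedTransportAtTwoHalfDescentLayerIndexGrowth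

end
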